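import Literature.Analysis.FluidPDE.HyperbolicConeEnergy
import Mathlib.Analysis.Calculus.FDeriv.Symmetric
import HarnessLib

/-!
# Domain of dependence for the `2+1` wave equation (energy method on cones)

Support file (everything proved, no named facts) for the explicit vacuum spacetime of
`Literature.Geometry.Lorentzian.christodoulou_trapped_surface_formation_holds`.

For a smooth `u : ℝ × ℝ² → ℝ` put `u_T = ∂u/∂T`, `u_j = ∂u/∂xʲ`, the energy density
`e = ½(u_T² + |∇u|²)`, the fluxes `f_j = −u_T u_j` and `□u = u_TT − Δu`. Then
`∂_T e + ∑ ∂_j f_j = u_T □u` (`WaveCone.bulk_eq`) and `|∑ νⱼ fⱼ| ≤ e` for `‖ν‖ ≤ 1`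
(`WaveCone.flux_le`), so the energy method on truncated cones of the tree
(`Literature.Analysis.FluidPDE.coneEnergy_eq_zero`, Racke 2015, Thm 3.1; John 1982, Ch. 5 §3)
gives **local uniqueness / finite speed of propagation**: if `□u = 0` on
`[0, T₀] × B̄(x₀, ρ)` with `ρ > T₀ > 0` and the Cauchy data of `u` vanish on an open
neighbourhood of `B̄(x₀, ρ)`, then `u(T₀, x₀) = 0` (`WaveCone.eq_zero_of_dalembert_eq_zero`;
Evans, *PDE*, §2.4.3, Thm 6 (domain of dependence); John, Ch. 5 §1).

## References

* L. C. Evans, *Partial Differential Equations*, 2nd ed., AMS 2010, §2.4.3 (Thm 6). [Evans2010]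
* F. John, *Partial Differential Equations*, 4th ed., Springer 1982, Ch. 5 §§1, 3. [John1982]
* R. Racke, *Lectures on Nonlinear Evolution Equations*, 2nd ed. 2015, Ch. 3 Thm 3.1. [Racke2015]
-/

noncomputable section

open Set Filter MeasureTheory Metric
open scoped Topology ContDiff RealInnerProductSpace

namespace Literature.Geometry.Lorentzian

namespace WaveCone

/-- The plane `ℝ²` (local abbreviation). [folklore] -/
abbrev E2 : Type := EuclideanSpace ℝ (Fin 2)

variable (u : ℝ × E2 → ℝ)

/-- The time derivative `u_T`. [folklore] -/
def dT (p : ℝ × E2) : ℝ := fderiv ℝ u p ((1 : ℝ), (0 : E2))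

/-- The spatial derivatives `u_j`. [folklore] -/
def dX (j : Fin 2) (p : ℝ × E2) : ℝ := fderiv ℝ u p ((0 : ℝ), EuclideanSpace.single j (1 : ℝ))

/-- The energy density `e = ½(u_T² + ∑ u_j²)`. [cite: Evans2010, §2.4.3] -/
def energy (p : ℝ × E2) : ℝ := 2⁻¹ * (dT u p ^ 2 + ∑ j, dX u j p ^ 2)

/-- The energy fluxes `f_j = −u_T u_j`. [cite: Evans2010, §2.4.3] -/
def flux (j : Fin 2) (p : ℝ × E2) : ℝ := -(dT u p * dX u j p)

/-- The d'Alembertian `□u = u_TT − ∑ u_jj`. [cite: Evans2010, §2.4] -/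
def dalembert (p : ℝ × E2) : ℝ :=
  fderiv ℝ (dT u) p ((1 : ℝ), (0 : E2)) - ∑ j, fderiv ℝ (dX u j) p ((0 : ℝ), EuclideanSpace.single j (1 : ℝ))

variable {u}

/-- Directional derivatives of a smooth function are smooth. [folklore] -/
theorem contDiff_fderiv_apply (hu : ContDiff ℝ ∞ u) (v : ℝ × E2) :
    ContDiff ℝ ∞ fun p ↦ fderiv ℝ u p v :=
  (hu.fderiv_right (m := ∞) le_rfl).clm_apply contDiff_const

/-- `u_T` is smooth. [folklore] -/
theorem contDiff_dT (hu : ContDiff ℝ ∞ u) : ContDiff ℝ ∞ (dT u) := contDiff_fderiv_apply hu _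

/-- `u_j` is smooth. [folklore] -/
theorem contDiff_dX (hu : ContDiff ℝ ∞ u) (j : Fin 2) : ContDiff ℝ ∞ (dX u j) :=
  contDiff_fderiv_apply hu _

/-- The energy density is smooth. [folklore] -/
theorem contDiff_energy (hu : ContDiff ℝ ∞ u) : ContDiff ℝ ∞ (energy u) := by
  unfold energy
  exact contDiff_const.mul (((contDiff_dT hu).pow 2).add
    (ContDiff.sum fun j _ ↦ (contDiff_dX hu j).pow 2))

/-- The fluxes are smooth. [folklore] -/
theorem contDiff_flux (hu : ContDiff ℝ ∞ u) (j : Fin 2) : ContDiff ℝ ∞ (flux u j) := by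
  unfold flux
  exact ((contDiff_dT hu).mul (contDiff_dX hu j)).neg

/-- Second directional derivatives through `D²u`: `∂_w (∂_v u) = D²u[w, v]`. [folklore] -/
theorem fderiv_fderiv_apply (hu : ContDiff ℝ ∞ u) (p v w : ℝ × E2) :
    fderiv ℝ (fun q ↦ fderiv ℝ u q v) p w = fderiv ℝ (fderiv ℝ u) p w v := by
  have hd : DifferentiableAt ℝ (fderiv ℝ u) p :=
    ((hu.fderiv_right (m := ∞) le_rfl).differentiable (by simp)) p
  rw [fderiv_clm_apply hd (differentiableAt_const v)]
  simp

/-- **Symmetry of second derivatives**: `∂_w ∂_v u = ∂_v ∂_w u` for smooth `u`. [folklore] -/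
theorem fderiv_fderiv_comm (hu : ContDiff ℝ ∞ u) (p v w : ℝ × E2) :
    fderiv ℝ (fun q ↦ fderiv ℝ u q v) p w = fderiv ℝ (fun q ↦ fderiv ℝ u q w) p v := by
  rw [fderiv_fderiv_apply hu, fderiv_fderiv_apply hu]
  exact (hu.contDiffAt.isSymmSndFDerivAt
    (by simp only [minSmoothness_of_isRCLikeNormedField]; exact WithTop.coe_le_coe.mpr le_top)) w v

/-- **The energy identity** `∂_T e + ∑ⱼ ∂ⱼ fⱼ = u_T □u`. [cite: Evans2010, §2.4.3] -/
theorem bulk_eq (hu : ContDiff ℝ ∞ u) (p : ℝ × E2) :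
    fderiv ℝ (energy u) p ((1 : ℝ), (0 : E2)) +
        ∑ j, fderiv ℝ (flux u j) p ((0 : ℝ), EuclideanSpace.single j (1 : ℝ)) =
      dT u p * dalembert u p := by
  have hTd : Differentiable ℝ (dT u) := (contDiff_dT hu).differentiable (by simp)
  have hXd : ∀ j, Differentiable ℝ (dX u j) := fun j ↦ (contDiff_dX hu j).differentiable (by simp)
  -- derivative of the energy
  have he : ∀ w, fderiv ℝ (energy u) p w =
      dT u p * fderiv ℝ (dT u) p w + ∑ j, dX u j p * fderiv ℝ (dX u j) p w := by
    intro w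
    have h1 := (hTd p).hasFDerivAt.pow 2
    have h2 := HasFDerivAt.fun_sum (u := Finset.univ) fun j (_ : j ∈ Finset.univ) ↦
      (hXd j p).hasFDerivAt.pow 2
    have hE := (h1.add h2).const_mul (2⁻¹ : ℝ)
    have hfd : fderiv ℝ (energy u) p = _ := hE.fderiv
    rw [hfd]
    simp only [FunLike.coe_smul, Pi.smul_apply, _root_.add_apply, FunLike.coe_sum, Finset.sum_apply,
      smul_eq_mul, pow_one, Nat.add_one_sub_one, nsmul_eq_mul, Nat.cast_ofNat]
    rw [mul_add, Finset.mul_sum]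
    congr 1
    · ring
    · exact Finset.sum_congr rfl fun j _ ↦ by ring
  -- derivative of the fluxes
  have hf : ∀ j w, fderiv ℝ (flux u j) p w =
      -(fderiv ℝ (dT u) p w * dX u j p + dT u p * fderiv ℝ (dX u j) p w) := by
    intro j w
    unfold flux
    rw [fderiv_fun_neg, fderiv_fun_mul (hTd p) (hXd j p)]
    simp only [_root_.neg_apply, _root_.add_apply, FunLike.coe_smul, Pi.smul_apply, smul_eq_mul]
    ring
  simp only [he, hf, dalembert, Finset.mul_sum, mul_sub, Finset.sum_neg_distrib]
  -- symmetry `∂_T u_j = ∂_j u_T`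
  have hsym : ∀ j, fderiv ℝ (dX u j) p ((1 : ℝ), (0 : E2)) =
      fderiv ℝ (dT u) p ((0 : ℝ), EuclideanSpace.single j (1 : ℝ)) := fun j ↦
    fderiv_fderiv_comm hu p _ _
  simp only [hsym]
  rw [Finset.sum_add_distrib]
  have hcomm : ∑ x, fderiv ℝ (dT u) p ((0 : ℝ), EuclideanSpace.single x (1 : ℝ)) * dX u x p =
      ∑ x, dX u x p * fderiv ℝ (dT u) p ((0 : ℝ), EuclideanSpace.single x (1 : ℝ)) :=
    Finset.sum_congr rfl fun _ _ ↦ mul_comm _ _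
  rw [hcomm]
  ring

/-- **The cone (dominant energy) condition** `|∑ νⱼ fⱼ| ≤ e` for `‖ν‖ ≤ 1`: Cauchy–Schwarz and
`|u_T| |∇u| ≤ ½(u_T² + |∇u|²)`. [cite: Evans2010, §2.4.3] -/
theorem flux_le (p : ℝ × E2) (ν : E2) (hν : ‖ν‖ ≤ 1) : |∑ j, ν j * flux u j p| ≤ 1 * energy u p := by
  set w : E2 := WithLp.toLp 2 fun j ↦ dX u j p with hw
  have hsum : ∑ j, ν j * flux u j p = -(dT u p * ⟪ν, w⟫) := by
    simp only [flux, hw, PiLp.inner_apply, RCLike.inner_apply, conj_trivial, Finset.mul_sum,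
      ← Finset.sum_neg_distrib]
    refine Finset.sum_congr rfl fun j _ ↦ ?_
    ring
  have hw2 : ‖w‖ ^ 2 = ∑ j, dX u j p ^ 2 := by
    rw [EuclideanSpace.norm_eq, Real.sq_sqrt (Finset.sum_nonneg fun j _ ↦ sq_nonneg _)]
    simp [hw, sq_abs]
  rw [hsum, abs_neg, abs_mul, one_mul, energy, ← hw2]
  have hcs : |⟪ν, w⟫| ≤ ‖ν‖ * ‖w‖ := abs_real_inner_le_norm ν w
  have h1 : |⟪ν, w⟫| ≤ ‖w‖ := hcs.trans (by nlinarith [norm_nonneg w, norm_nonneg ν])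
  calc |dT u p| * |⟪ν, w⟫| ≤ |dT u p| * ‖w‖ := by gcongr
    _ ≤ 2⁻¹ * (dT u p ^ 2 + ‖w‖ ^ 2) := by
        nlinarith [sq_nonneg (|dT u p| - ‖w‖), sq_abs (dT u p), norm_nonneg w, abs_nonneg (dT u p)]

/-- The energy is nonnegative. [folklore] -/
theorem energy_nonneg (p : ℝ × E2) : 0 ≤ energy u p := by
  unfold energy
  positivity

/-- Spatial derivatives of the datum: if `u(0, ·)` vanishes on an open set then so do the
`u_j(0, ·)` there. [folklore] -/
theorem dX_zero_of_eqOn (hu : ContDiff ℝ ∞ u) {U : Set E2} (hU : IsOpen U)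
    (h0 : ∀ x ∈ U, u (0, x) = 0) (j : Fin 2) {x : E2} (hx : x ∈ U) : dX u j (0, x) = 0 := by
  -- the slice `s y = u (0, y)` vanishes near `x`, and `u_j (0, x) = ∂_j s (x)`
  have hs : HasFDerivAt (fun y : E2 ↦ u ((0 : ℝ), y))
      ((fderiv ℝ u ((0 : ℝ), x)).comp (ContinuousLinearMap.inr ℝ ℝ E2)) x := by
    have h1 : HasFDerivAt u (fderiv ℝ u ((0 : ℝ), x)) ((0 : ℝ), x) :=
      ((hu.differentiable (by simp)) _).hasFDerivAt
    exact h1.comp x ((hasFDerivAt_const (0 : ℝ) x).prodMk (hasFDerivAt_id x))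
  have hzero : fderiv ℝ (fun y : E2 ↦ u ((0 : ℝ), y)) x = 0 := by
    have hev : (fun y : E2 ↦ u ((0 : ℝ), y)) =ᶠ[𝓝 x] fun _ ↦ 0 :=
      Filter.eventually_of_mem (hU.mem_nhds hx) fun y hy ↦ h0 y hy
    rw [hev.fderiv_eq, fderiv_fun_const]; rfl
  have h := congrArg (fun L : E2 →L[ℝ] ℝ ↦ L (EuclideanSpace.single j (1 : ℝ))) (hs.fderiv.symm.trans hzero)
  simpa [dX] using h

/-- **Domain of dependence for `□u = 0` (local uniqueness on a cone).** Let `u` be smooth on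
`ℝ × ℝ²` with `□u = 0` on `[0, T₀] × B̄(x₀, ρ)`, `0 < T₀ < ρ`, and suppose the Cauchy data
`u(0, ·)`, `u_T(0, ·)` vanish on an open neighbourhood of `B̄(x₀, ρ)`. Then `u(T₀, x₀) = 0`
(energy method on the truncated cone, `coneEnergy_eq_zero`; Evans §2.4.3 Thm 6).
[cite: Evans2010, §2.4.3, Thm 6] -/
theorem eq_zero_of_dalembert_eq_zero (hu : ContDiff ℝ ∞ u) {T₀ ρ : ℝ} {x₀ : E2} (hT₀ : 0 < T₀)
    (hρ : T₀ < ρ) (hwave : ∀ p ∈ Icc 0 T₀ ×ˢ closedBall x₀ ρ, dalembert u p = 0)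
    {U : Set E2} (hU : IsOpen U) (hUρ : closedBall x₀ ρ ⊆ U) (h0 : ∀ x ∈ U, u (0, x) = 0)
    (h1 : ∀ x ∈ U, dT u (0, x) = 0) : u (T₀, x₀) = 0 := by
  have hec := contDiff_energy hu
  have hfc := contDiff_flux hu
  -- bound on `De` on the compact slab piece
  obtain ⟨C, hC⟩ : ∃ C, ∀ p ∈ Icc 0 T₀ ×ˢ closedBall x₀ ρ, ‖fderiv ℝ (energy u) p‖ ≤ C := by
    have hK : IsCompact (Icc 0 T₀ ×ˢ closedBall x₀ ρ) :=
      isCompact_Icc.prod (isCompact_closedBall x₀ ρ)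
    exact hK.exists_bound_of_continuousOn
      ((hec.continuous_fderiv (by simp)).continuousOn)
  -- the energy vanishes on the cone
  have hE : ∀ t ∈ Ioc 0 T₀, ∀ x, dist x x₀ < ρ - 1 * (t - 0) → energy u (t, x) = 0 := by
    intro t ht x hx
    refine Literature.Analysis.FluidPDE.coneEnergy_eq_zero (d := 2) (τ := 0) (τ' := T₀) (ρ := ρ)
      (c := 1) (M := 0) (C := C) (x₁ := x₀) (e := energy u) (f := flux u) zero_le_one
      hec.continuous.continuousOn (hec.of_le (by simp)).contDiffOn
      (fun j ↦ ((hfc j).of_le (by simp)).contDiffOn)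
      (fun p hp ↦ hC p ⟨Ioo_subset_Icc_self hp.1, hp.2⟩) (fun p _ ↦ energy_nonneg p)
      (fun p hp ↦ ?_) (fun p _ ν hν ↦ flux_le p ν hν) (fun x hx ↦ ?_) ht hx
    · rw [bulk_eq hu p, hwave p ⟨Ioo_subset_Icc_self hp.1, hp.2⟩, mul_zero, zero_mul]
    · -- vanishing of the initial energy
      have hxU : x ∈ U := hUρ hx
      unfold energy
      rw [h1 x hxU]
      simp [dX_zero_of_eqOn hu hU h0 _ hxU]
  -- along the axis of the cone `u_T (t, x₀) = 0`, so `u (·, x₀)` is constant on `[0, T₀]`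
  have hT : ∀ t ∈ Ico 0 T₀, dT u (t, x₀) = 0 := by
    intro t ht
    rcases ht.1.eq_or_lt with rfl | hpos
    · exact h1 x₀ (hUρ (mem_closedBall_self (by linarith)))
    · have h := hE t ⟨hpos, ht.2.le⟩ x₀ (by simp; linarith [ht.2])
      unfold energy at h
      have h2 : dT u (t, x₀) ^ 2 = 0 := by
        nlinarith [Finset.sum_nonneg fun j (_ : j ∈ Finset.univ) ↦ sq_nonneg (dX u j (t, x₀)),
          sq_nonneg (dT u (t, x₀))]
      exact pow_eq_zero_iff (n := 2) (by norm_num) |>.1 h2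
  -- the line `t ↦ u (t, x₀)`
  have hline : ∀ t, HasDerivAt (fun s : ℝ ↦ u (s, x₀)) (dT u (t, x₀)) t := by
    intro t
    have h1' : HasFDerivAt u (fderiv ℝ u (t, x₀)) (t, x₀) := ((hu.differentiable (by simp)) _).hasFDerivAt
    have h2 : HasDerivAt (fun s : ℝ ↦ ((s, x₀) : ℝ × E2)) ((1 : ℝ), (0 : E2)) t :=
      (hasDerivAt_id t).prodMk (hasDerivAt_const t x₀)
    exact h1'.comp_hasDerivAt t h2
  have hconst := constant_of_derivWithin_zero (f := fun s : ℝ ↦ u (s, x₀)) (a := 0) (b := T₀)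
    (fun t _ ↦ (hline t).differentiableAt.differentiableWithinAt) (fun t ht ↦ by
      rw [(hline t).hasDerivWithinAt.derivWithin (uniqueDiffOn_Icc hT₀ t (Ico_subset_Icc_self ht))]
      exact hT t ht)
  have h := hconst T₀ (right_mem_Icc.2 hT₀.le)
  rw [h]
  exact h0 x₀ (hUρ (mem_closedBall_self (by linarith)))

end WaveCone

end Literature.Geometry.Lorentzian
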